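import Summits.BirchSwinnertonDyer.BirchSwinnertonDyer.Theorems.Rank2ObservatoryRank3PSatCertU
import Summits.BirchSwinnertonDyer.BirchSwinnertonDyer.Theorems.Rank2ObservatoryTorsionCertA
import HarnessLib

/-!
# BirchSwinnertonDyer — rank ≥ 2 observatory: rank-3 `3`-saturation, lane T (no `3`-torsion)

HONEST FRAMING: per-curve certified theorems and census instruments; no claim on BSD in rank ≥ 2.

The `3`-saturation instruments `Rank2ObservatoryRank3PSatCert[C|CL]` (lane `u = 0`, `3 ∤ t`) and
`Rank2ObservatoryRank3PSatCertU` (deep primes, `3 ∣ t`) leave 12 rows of the rank-3 table: the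
curves that are `3`-ISOGENOUS IMAGES `E' = E/⟨T⟩` of a curve with a rational point `T` of order `3`.
Their tabulated torsion annihilator is `t = 3` (the engines bound torsion by `gcd #Ẽ(𝔽_ℓ)`, and
`3 ∣ #Ẽ'(𝔽_ℓ)` at every good `ℓ`), yet `E'(ℚ)[3] = 0`; and the class of `E(ℚ)/⟨T⟩ ↪ E'(ℚ)` is
divisible by `3` modulo every good prime of `3`-rank one, so it has NO lane-0 / deep-prime witness.
This file supplies the instrument for them:

* **no rational `3`-torsion** is the landed certificate `eq_zero_of_three_nsmul_eq_zero` of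
  `Rank2ObservatoryTorsionCertA` (`ψ₃ = (q₀X − p₀)·c`, `c` root-free by residues `noRatRootB`,
  fibre discriminant `threeDiscZ` a non-square by `nonSquareB`); then `t = 3^e · m` kills the
  torsion already with `m` (`nsmul_eq_zero_of_noThreeTorsion`);
* **full-`3`-torsion witnesses** (`pWitnessT`, soundness `not_mem_pCoset_of_pWitnessT`): at a good
  prime `q` with two certified points `T̃, Ũ` of order `3` (tangent certificates `zmodTangent`
  with `2T̃ = −T̃`) and `x(T̃) ≠ x(Ũ)`, `Ẽ(𝔽_q) ⊇ ℤ/3 × ℤ/3`, so `(N/3)·Ẽ(𝔽_q) = 0`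
  (`nsmul_card_div_three_eq_zero`, Lagrange for the image of `ℤ/3 × ℤ/3`); hence
  `(N/9)·R̃ ≠ O` (the validated three-generator chain of `pWitnessC` at "`p = 9`") shows
  `R ∉ 3E'(ℚ)`;
* the row Boolean `rank3PSatCheckT` (each class served by a lane-0 witness `pWitnessC` OR a
  full-`3`-torsion witness), `Rank3Row.pSaturated_of_pSatCheckT`, list form `rank3PSatCheckTAll`,
  **`Rank3Row.pSaturated_of_pSatCheckTAll`** — same conclusion shape as the other lanes, so the
  census glue is unchanged.

Sorry-free; no `decide` executed on table data here; no instances, no notation.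

References: J. H. Silverman, AEC (2009) III.2.3, Ex. 3.7 (`ψ₃`), VII.3.1; J. E. Cremona,
*Algorithms for Modular Elliptic Curves* (1997) §3.3, §3.5; S. Siksek, Rocky Mountain J. Math. 25
(1995) §3.
-/

-- single-conjunct summit: `Summit.BirchSwinnertonDyer.BirchSwinnertonDyer.…` repeats the name
set_option linter.dupNamespace false

namespace Summit.BirchSwinnertonDyer.BirchSwinnertonDyer.Rank2Observatory

open WeierstrassCurve

/-- With `E'(ℚ)[3] = 0`, an element killed by `3^e · m` is killed by `m`. [folklore] -/
theorem nsmul_eq_zero_of_noThreeTorsion {A : Type*} [AddCommGroup A]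
    (h3 : ∀ τ : A, 3 • τ = 0 → τ = 0) {m : ℕ} :
    ∀ (e : ℕ) (x : A), (3 ^ e * m) • x = 0 → m • x = 0
  | 0, x, hx => by simpa using hx
  | e + 1, x, hx => by
    refine nsmul_eq_zero_of_noThreeTorsion h3 e x (h3 _ ?_)
    rw [← mul_nsmul', ← hx]
    congr 1
    ring

/-- **Two independent points of order `3` force exponent `∣ N/3`.** In a finite abelian group
`G` with `T + T = −T`, `U + U = −U`, `T ≠ 0` and `U ∉ {0, T, −T}`, the map
`ℤ/3 × ℤ/3 → G, (i, j) ↦ iT + jU` is an injective homomorphism, its image `K` has order `9`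
(so `9 ∣ #G`), and `(#G / 3) • Z = 3 • ([G : K] • Z) ∈ 3 • K = 0`. [folklore] -/
theorem nsmul_card_div_three_eq_zero {G : Type*} [AddCommGroup G] [Finite G] {T U : G}
    (hT : T + T = -T) (hU : U + U = -U) (hT0 : T ≠ 0) (hU0 : U ≠ 0) (hUT : U ≠ T)
    (hUT' : U ≠ -T) (Z : G) : (Nat.card G / 3) • Z = 0 := by
  have h3T : 3 • T = 0 := by
    rw [show (3 : ℕ) = 2 + 1 from rfl, succ_nsmul, two_nsmul, hT, neg_add_cancel]
  have h3U : 3 • U = 0 := by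
    rw [show (3 : ℕ) = 2 + 1 from rfl, succ_nsmul, two_nsmul, hU, neg_add_cancel]
  have hmod : ∀ W : G, 3 • W = 0 → ∀ n : ℕ, (n % 3) • W = n • W := by
    intro W hW n
    conv_rhs => rw [← Nat.mod_add_div n 3, add_nsmul, mul_comm, mul_nsmul', hW, nsmul_zero,
      add_zero]
  -- no non-trivial relation `iT + jU = 0` with `i, j < 3`
  have indep : ∀ i j : ℕ, i < 3 → j < 3 → i • T + j • U = 0 → i = 0 ∧ j = 0 := by
    intro i j hi hj h
    interval_cases i <;> interval_cases j <;>
      simp only [zero_nsmul, one_nsmul, two_nsmul, zero_add, add_zero, hT, hU] at h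
    · exact ⟨rfl, rfl⟩
    · exact absurd h hU0
    · exact absurd (neg_eq_zero.mp h) hU0
    · exact absurd h hT0
    · exact absurd (eq_neg_of_add_eq_zero_right h) hUT'
    · exact absurd (add_neg_eq_zero.mp h).symm hUT
    · exact absurd (neg_eq_zero.mp h) hT0
    · exact absurd (neg_add_eq_zero.mp h).symm hUT
    · refine absurd ?_ hUT'
      rw [(neg_add_eq_zero.mp h), neg_neg]
  let f : ZMod 3 × ZMod 3 →+ G := AddMonoidHom.mk' (fun v => v.1.val • T + v.2.val • U) (by
    intro v w
    simp only [Prod.fst_add, Prod.snd_add, ZMod.val_add]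
    rw [hmod T h3T, hmod U h3U, add_nsmul, add_nsmul]
    abel)
  have hf : Function.Injective f := by
    rw [injective_iff_map_eq_zero]
    rintro ⟨i, j⟩ h
    have hij := indep i.val j.val (ZMod.val_lt i) (ZMod.val_lt j) h
    exact Prod.ext ((ZMod.val_eq_zero i).mp hij.1) ((ZMod.val_eq_zero j).mp hij.2)
  have hK : Nat.card f.range = 9 := by
    rw [← Nat.card_congr (AddMonoidHom.ofInjective hf).toEquiv, Nat.card_prod, Nat.card_zmod]
  have hidx : f.range.index * 9 = Nat.card G := by rw [← hK]; exact f.range.index_mul_card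
  obtain ⟨v, hv⟩ := AddMonoidHom.mem_range.mp (f.range.nsmul_index_mem Z)
  have h3v : (3 : ℕ) • v = 0 := (by decide : ∀ w : ZMod 3 × ZMod 3, 3 • w = 0) v
  have e : Nat.card G / 3 = 3 * f.range.index := by omega
  rw [e, mul_nsmul', ← hv, ← map_nsmul, h3v, map_zero]

/-- FULL-`3`-TORSION WITNESS CHECK for the class `(a, b, c)` at `(q, N, x₁, y₁, x₂, y₂)`: two
points `(x₁, y₁)`, `(x₂, y₂)` on `V mod q` with tangent certificates `2T̃ = −T̃` (`zmodTangent`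
to `(xᵢ, −yᵢ − a₁xᵢ − a₃)`) and `x₁ ≠ x₂`, and the computed, validated three-generator chain of
`pWitnessC` at modulus "`p = 9`" (`N = 9·m`, joint plan for `(ma, mb, mc)`, nonzero end point).
[cite: CremonaAlgorithms1997, §3.5] -/
def pWitnessT (V : WeierstrassCurve ℤ) (X₁ Y₁ X₂ Y₂ X₃ Y₃ : ℤ) (abc : ℤ × ℤ × ℤ) :
    ℕ × ℕ × ℕ × ℕ × ℕ × ℕ → Bool
  | (0, _) => false
  | (q + 1, N, x₁, y₁, x₂, y₂) =>
    decide ((x₁ : ZMod (q + 1)) ≠ (x₂ : ZMod (q + 1)) ∧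
        (y₁ : ZMod (q + 1)) ^ 2 + (V.a₁ : ZMod (q + 1)) * x₁ * y₁ + (V.a₃ : ZMod (q + 1)) * y₁ =
          (x₁ : ZMod (q + 1)) ^ 3 + (V.a₂ : ZMod (q + 1)) * x₁ ^ 2 + (V.a₄ : ZMod (q + 1)) * x₁
            + (V.a₆ : ZMod (q + 1)) ∧
        (y₂ : ZMod (q + 1)) ^ 2 + (V.a₁ : ZMod (q + 1)) * x₂ * y₂ + (V.a₃ : ZMod (q + 1)) * y₂ =
          (x₂ : ZMod (q + 1)) ^ 3 + (V.a₂ : ZMod (q + 1)) * x₂ ^ 2 + (V.a₄ : ZMod (q + 1)) * x₂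
            + (V.a₆ : ZMod (q + 1))) &&
      zmodTangent V (q + 1) x₁ y₁ x₁ (-(y₁ : ZMod (q + 1)) - (V.a₁ : ZMod (q + 1)) * x₁ - V.a₃) &&
      zmodTangent V (q + 1) x₂ y₂ x₂ (-(y₂ : ZMod (q + 1)) - (V.a₁ : ZMod (q + 1)) * x₂ - V.a₃) &&
      pWitnessC V 9 X₁ Y₁ X₂ Y₂ X₃ Y₃ abc (q + 1, N)

section WitnessT

variable (V : WeierstrassCurve ℤ) (q : ℕ) [Fact q.Prime]

/-- A certified point of order `3` on `V mod q`: on the curve, tangent certificate to its own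
negative; then `T̃ + T̃ = −T̃` in `Ẽ(𝔽_q)`. [cite: SilvermanAEC2009, III.2.3] -/
theorem exists_order3_of_zmodTangent (hq : ¬ (q : ℤ) ∣ V.Δ) {x y : ℕ}
    (he : (y : ZMod q) ^ 2 + (V.a₁ : ZMod q) * x * y + (V.a₃ : ZMod q) * y =
      (x : ZMod q) ^ 3 + (V.a₂ : ZMod q) * x ^ 2 + (V.a₄ : ZMod q) * x + (V.a₆ : ZMod q))
    (ht : zmodTangent V q x y x (-(y : ZMod q) - (V.a₁ : ZMod q) * x - V.a₃) = true) :
    ∃ h : (V.map (Int.castRingHom (ZMod q))).toAffine.Nonsingular (x : ZMod q) (y : ZMod q),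
      (Affine.Point.some _ _ h : (V.map (Int.castRingHom (ZMod q))).toAffine.Point) + .some _ _ h
        = -.some _ _ h := by
  classical
  have hE : (V.map (Int.castRingHom (ZMod q))).toAffine.Equation (x : ZMod q) (y : ZMod q) := by
    rw [Affine.equation_iff]
    simpa [WeierstrassCurve.map] using he
  have h := (Affine.equation_iff_nonsingular_of_Δ_ne_zero (Δ_zmod_ne_zero V q hq)).mp hE
  obtain ⟨h₃, hd⟩ := exists_some_add_self_of_zmodTangent V q h ht
  refine ⟨h, ?_⟩
  rw [hd, Affine.Point.neg_some]
  have hnegY : (V.map (Int.castRingHom (ZMod q))).toAffine.negY (x : ZMod q) (y : ZMod q)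
      = -(y : ZMod q) - (V.a₁ : ZMod q) * x - V.a₃ := by
    simp [Affine.negY, WeierstrassCurve.map]
  simp only [hnegY]

open scoped Classical in
/-- **Soundness of the full-`3`-torsion witness**: `aP₁ + bP₂ + cP₃ ∉ 3•E'(ℚ) = pCoset _ 3 0`
for the integral points `Pᵢ = (Xᵢ, Yᵢ)` of `E' = V`: reduce modulo `q`; `(N/3) • Ẽ'(𝔽_q) = 0`
(`nsmul_card_div_three_eq_zero`) while `(N/9) • (aP̃₁ + bP̃₂ + cP̃₃) ≠ O`
(`combo_ne_zero_of_chain3B`), so `not_mem_pCoset_of_nsmul_ne_zero'` applies with `k = N/9`.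
[cite: SilvermanAEC2009, VII.3] -/
theorem not_mem_pCoset_of_pWitnessT (hΔ : V.Δ ≠ 0) {N x₁ y₁ x₂ y₂ : ℕ}
    (hqN : killerB V (q, N) = true) {X₁ Y₁ X₂ Y₂ X₃ Y₃ : ℤ}
    (e₁ : Y₁ ^ 2 + V.a₁ * X₁ * Y₁ + V.a₃ * Y₁ = X₁ ^ 3 + V.a₂ * X₁ ^ 2 + V.a₄ * X₁ + V.a₆)
    (e₂ : Y₂ ^ 2 + V.a₁ * X₂ * Y₂ + V.a₃ * Y₂ = X₂ ^ 3 + V.a₂ * X₂ ^ 2 + V.a₄ * X₂ + V.a₆)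
    (e₃ : Y₃ ^ 2 + V.a₁ * X₃ * Y₃ + V.a₃ * Y₃ = X₃ ^ 3 + V.a₂ * X₃ ^ 2 + V.a₄ * X₃ + V.a₆)
    {a b c : ℤ} (hw : pWitnessT V X₁ Y₁ X₂ Y₂ X₃ Y₃ (a, b, c) (q, N, x₁, y₁, x₂, y₂) = true) :
    a • (Affine.Point.some (X₁ : ℚ) (Y₁ : ℚ) (nonsingular_rat_of_eq V hΔ e₁) :
        (V.map (Int.castRingHom ℚ)).toAffine.Point)
      + b • Affine.Point.some (X₂ : ℚ) (Y₂ : ℚ) (nonsingular_rat_of_eq V hΔ e₂)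
      + c • Affine.Point.some (X₃ : ℚ) (Y₃ : ℚ) (nonsingular_rat_of_eq V hΔ e₃) ∉
      pCoset (V.map (Int.castRingHom ℚ)).toAffine.Point 3 0 := by
  cases q with
  | zero => exact absurd (Fact.out : (0 : ℕ).Prime) Nat.not_prime_zero
  | succ q =>
    obtain ⟨-, hq, hcount⟩ := killerB_sound V hqN
    simp only [pWitnessT, Bool.and_eq_true, decide_eq_true_eq] at hw
    obtain ⟨⟨⟨⟨hx, eq₁, eq₂⟩, ht₁⟩, ht₂⟩, hw⟩ := hw
    simp only [pWitnessC, Bool.and_eq_true, decide_eq_true_eq] at hw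
    obtain ⟨hNk, hrest⟩ := hw
    split at hrest
    · exact absurd hrest Bool.false_ne_true
    · rename_i tr htr
      simp only [Bool.and_eq_true, decide_eq_true_eq] at hrest
      obtain ⟨hchain, hcoef⟩ := hrest
      have E₁ : V.toAffine.Equation X₁ Y₁ := (Affine.equation_iff X₁ Y₁).mpr e₁
      have E₂ : V.toAffine.Equation X₂ Y₂ := (Affine.equation_iff X₂ Y₂).mpr e₂
      have E₃ : V.toAffine.Equation X₃ Y₃ := (Affine.equation_iff X₃ Y₃).mpr e₃
      obtain ⟨hT, hTT⟩ := exists_order3_of_zmodTangent V (q + 1) hq eq₁ ht₁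
      obtain ⟨hU, hUU⟩ := exists_order3_of_zmodTangent V (q + 1) hq eq₂ ht₂
      haveI : Finite (V.map (Int.castRingHom (ZMod (q + 1)))).toAffine.Point :=
        Nat.finite_of_card_ne_zero (by
          rw [natCard_point_eq_zmodPointCount V (q + 1) hq, zmodPointCount]
          exact Nat.succ_ne_zero _)
      have hkill : ∀ Z : (V.map (Int.castRingHom (ZMod (q + 1)))).toAffine.Point,
          (3 * (N / 9)) • Z = 0 := by
        intro Z
        have key := nsmul_card_div_three_eq_zero hTT hUU (Affine.Point.some_ne_zero hT)
          (Affine.Point.some_ne_zero hU) (fun h => hx ?_) (fun h => hx ?_) Z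
        · rw [natCard_point_eq_zmodPointCount V (q + 1) hq, hcount] at key
          have e : N / 3 = 3 * (N / 9) := by omega
          rwa [e] at key
        · rw [Affine.Point.some.injEq] at h
          exact h.1.symm
        · rw [Affine.Point.neg_some, Affine.Point.some.injEq] at h
          exact h.1.symm
      refine not_mem_pCoset_of_map_not_mem (reduceMod V (q + 1) hq) ?_
      rw [map_add, map_add, map_zsmul, map_zsmul, map_zsmul, reduceMod_some V (q + 1) hq E₁ _,
        reduceMod_some V (q + 1) hq E₂ _, reduceMod_some V (q + 1) hq E₃ _]
      refine not_mem_pCoset_of_nsmul_ne_zero' (p := 3) (u := 0) (k := N / 9) hkill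
        (by simp) ?_
      have e : (N / 9) •
            (a • (Affine.Point.some (X₁ : ZMod (q + 1)) (Y₁ : ZMod (q + 1))
                (nonsingular_zmod_of_equation V (q + 1) hq E₁) :
                (V.map (Int.castRingHom (ZMod (q + 1)))).toAffine.Point)
              + b • Affine.Point.some (X₂ : ZMod (q + 1)) (Y₂ : ZMod (q + 1))
                (nonsingular_zmod_of_equation V (q + 1) hq E₂)
              + c • Affine.Point.some (X₃ : ZMod (q + 1)) (Y₃ : ZMod (q + 1))
                (nonsingular_zmod_of_equation V (q + 1) hq E₃)) =
          (((N / 9 : ℕ) : ℤ) * a) • Affine.Point.some (X₁ : ZMod (q + 1)) (Y₁ : ZMod (q + 1))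
              (nonsingular_zmod_of_equation V (q + 1) hq E₁)
            + (((N / 9 : ℕ) : ℤ) * b) • Affine.Point.some (X₂ : ZMod (q + 1)) (Y₂ : ZMod (q + 1))
              (nonsingular_zmod_of_equation V (q + 1) hq E₂)
            + (((N / 9 : ℕ) : ℤ) * c) • Affine.Point.some (X₃ : ZMod (q + 1)) (Y₃ : ZMod (q + 1))
              (nonsingular_zmod_of_equation V (q + 1) hq E₃) := by
        module
      rw [e]
      have hne := combo_ne_zero_of_chain3B V (q + 1) (nonsingular_zmod_of_equation V (q + 1) hq E₁)
        (nonsingular_zmod_of_equation V (q + 1) hq E₂)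
        (nonsingular_zmod_of_equation V (q + 1) hq E₃) _ hchain
      rwa [hcoef] at hne

end WitnessT

open scoped Classical in
/-- **`3`-saturation on the integral model, lane T**: `E'(ℚ)[3] = 0` by the landed
`eq_zero_of_three_nsmul_eq_zero` (`psi3FactorB`, `noRatRootB`, `nonSquareB ∘ threeDiscZ` of
`Rank2ObservatoryTorsionCertA`), so `t = 3^e · m` (`annihilatorCheck`) gives `m • E'(ℚ)_tors = 0`
with `3 ∤ m`; every normalised class is served by a lane-0 witness (`pWitnessC`) or a
full-`3`-torsion witness (`pWitnessT`); conclude by `listedSpan_saturated_of_not_mem_pCoset` at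
`u = 0`. [cite: CremonaAlgorithms1997, §3.5] -/
theorem pSaturated_of_certPT (V : WeierstrassCurve ℤ) (hΔ : V.Δ ≠ 0) {X₁ Y₁ X₂ Y₂ X₃ Y₃ : ℤ}
    (e₁ : Y₁ ^ 2 + V.a₁ * X₁ * Y₁ + V.a₃ * Y₁ = X₁ ^ 3 + V.a₂ * X₁ ^ 2 + V.a₄ * X₁ + V.a₆)
    (e₂ : Y₂ ^ 2 + V.a₁ * X₂ * Y₂ + V.a₃ * Y₂ = X₂ ^ 3 + V.a₂ * X₂ ^ 2 + V.a₄ * X₂ + V.a₆)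
    (e₃ : Y₃ ^ 2 + V.a₁ * X₃ * Y₃ + V.a₃ * Y₃ = X₃ ^ 3 + V.a₂ * X₃ ^ 2 + V.a₄ * X₃ + V.a₆)
    {S : List (ℕ × ℕ)} {t e m : ℕ}
    (hS : ∀ ℓN ∈ S, ℓN.1.Prime ∧
      ∀ (x : (V.map (Int.castRingHom ℚ)).toAffine.Point) (n : ℕ), ¬ ℓN.1 ∣ n → n • x = 0 →
        ℓN.2 • x = 0)
    (ht : annihilatorCheck S t = true) (htm : t = 3 ^ e * m) (hm : ¬ (3 : ℤ) ∣ (m : ℤ))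
    {p₀ q₀ c₃ c₂ c₁ c₀ : ℤ} {m₁ m₂ : ℕ} (hfac : psi3FactorB V p₀ q₀ c₃ c₂ c₁ c₀ = true)
    (hc : noRatRootB c₃ c₂ c₁ c₀ m₁ = true) (hD : nonSquareB (threeDiscZ V p₀ q₀) m₂ = true)
    {Q : List (ℕ × ℕ)} (hQ : Q.all (killerB V) = true) {QT : List (ℕ × ℕ × ℕ × ℕ × ℕ × ℕ)}
    (hQT : (QT.map fun w => (w.1, w.2.1)).all (killerB V) = true)
    (hall : (normTriples 3).all (fun abc => Q.any (pWitnessC V 3 X₁ Y₁ X₂ Y₂ X₃ Y₃ abc) ||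
      QT.any (pWitnessT V X₁ Y₁ X₂ Y₂ X₃ Y₃ abc)) = true) :
    ∀ x : (V.map (Int.castRingHom ℚ)).toAffine.Point,
      3 • x ∈ AddSubgroup.closure
          {Affine.Point.some (X₁ : ℚ) (Y₁ : ℚ) (nonsingular_rat_of_eq V hΔ e₁),
            Affine.Point.some (X₂ : ℚ) (Y₂ : ℚ) (nonsingular_rat_of_eq V hΔ e₂),
            Affine.Point.some (X₃ : ℚ) (Y₃ : ℚ) (nonsingular_rat_of_eq V hΔ e₃)} ⊔
          AddCommGroup.torsion _ →
      x ∈ AddSubgroup.closure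
          {Affine.Point.some (X₁ : ℚ) (Y₁ : ℚ) (nonsingular_rat_of_eq V hΔ e₁),
            Affine.Point.some (X₂ : ℚ) (Y₂ : ℚ) (nonsingular_rat_of_eq V hΔ e₂),
            Affine.Point.some (X₃ : ℚ) (Y₃ : ℚ) (nonsingular_rat_of_eq V hΔ e₃)} ⊔
          AddCommGroup.torsion _ := by
  -- a listed class has a certified lane-0 prime OR a certified full-`3`-torsion prime
  have W : ∀ {a b c : ℤ}, (a, b, c) ∈ normTriples 3 →
      a • (Affine.Point.some (X₁ : ℚ) (Y₁ : ℚ) (nonsingular_rat_of_eq V hΔ e₁) :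
          (V.map (Int.castRingHom ℚ)).toAffine.Point)
        + b • Affine.Point.some (X₂ : ℚ) (Y₂ : ℚ) (nonsingular_rat_of_eq V hΔ e₂)
        + c • Affine.Point.some (X₃ : ℚ) (Y₃ : ℚ) (nonsingular_rat_of_eq V hΔ e₃) ∉
        pCoset (V.map (Int.castRingHom ℚ)).toAffine.Point 3 0 := by
    intro a b c h
    have h1 := List.all_eq_true.mp hall _ h
    rcases (Bool.or_eq_true _ _).mp h1 with h2 | h2
    · obtain ⟨⟨q, N⟩, hmem, hw⟩ := List.any_eq_true.mp h2
      exact not_mem_pCoset_of_pWitnessC V hΔ (List.all_eq_true.mp hQ _ hmem) e₁ e₂ e₃ hw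
    · obtain ⟨⟨q, N, x₁, y₁, x₂, y₂⟩, hmem, hw⟩ := List.any_eq_true.mp h2
      have hqN : killerB V (q, N) = true :=
        List.all_eq_true.mp hQT _ (List.mem_map.mpr ⟨_, hmem, rfl⟩)
      cases q with
      | zero => simp [pWitnessT] at hw
      | succ q =>
        haveI : Fact (q + 1).Prime := ⟨(killerB_sound V hqN).1⟩
        exact not_mem_pCoset_of_pWitnessT V (q + 1) hΔ hqN e₁ e₂ e₃ hw
  have h3 : ∀ τ : (V.map (Int.castRingHom ℚ)).toAffine.Point, 3 • τ = 0 → τ = 0 :=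
    eq_zero_of_three_nsmul_eq_zero V hfac hc hD
  refine listedSpan_saturated_of_not_mem_pCoset Nat.prime_three (u := 0) (m := (m : ℤ))
    (isCoprime_of_prime_of_not_dvd Nat.prime_three hm) ?_
    (residues_of_normalised Nat.prime_three ?_ ?_ ?_)
  · intro x hx
    rw [pow_zero, one_mul, natCast_zsmul]
    refine nsmul_eq_zero_of_noThreeTorsion h3 e x ?_
    rw [← htm]
    exact nsmul_eq_zero_of_annihilatorCheck hS ht hx
  · intro b c hb hb' hc hc'
    simpa only [one_smul, one_zsmul] using W (mem_normTriples₁ hb hb' hc hc')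
  · intro c hc hc'
    simpa only [zero_smul, zero_zsmul, zero_add, one_smul, one_zsmul]
      using W (mem_normTriples₂ hc hc')
  · simpa only [zero_smul, zero_zsmul, zero_add, one_smul, one_zsmul]
      using W (mem_normTriples₃ 3)

/-- The lane-T row datum: the `3`-exponent `e` of the torsion annihilator (`t = 3^e · m`), the
trivial-`3`-torsion certificate (`ψ₃ = (q₀X − p₀)·(c₃X³ + c₂X² + c₁X + c₀)`, residue moduli
`m₁`, `m₂`), the full-`3`-torsion witnesses `(q, N, x₁, y₁, x₂, y₂)`, and the dense datum of
`Rank2ObservatoryRank3PSatCertC` (scale, scaled generators, counts `S`, annihilator `t`, lane-0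
witness primes with counts `Q`). [cite: CremonaAlgorithms1997, §3.5] -/
structure Rank3PSatCertT where
  /-- the exponent `e` with `t = 3^e · m`, `3 ∤ m` -/
  e : ℕ
  /-- `ψ₃ = (q₀X − p₀)·(c₃X³ + c₂X² + c₁X + c₀)` -/
  p₀ : ℤ
  /-- see `p₀` -/
  q₀ : ℤ
  /-- see `p₀` -/
  c₃ : ℤ
  /-- see `p₀` -/
  c₂ : ℤ
  /-- see `p₀` -/
  c₁ : ℤ
  /-- see `p₀` -/
  c₀ : ℤ
  /-- residue modulus: the cubic cofactor has no root mod `m₁` -/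
  m₁ : ℕ
  /-- residue modulus: the fibre discriminant `threeDiscZ` is a non-square mod `m₂` -/
  m₂ : ℕ
  /-- full-`3`-torsion witnesses `(q, N, x₁, y₁, x₂, y₂)` -/
  QT : List (ℕ × ℕ × ℕ × ℕ × ℕ × ℕ)
  /-- the dense lane-0 datum -/
  c : Rank3PSatCertC

/-- **The lane-T row Boolean** (kernel `decide`, `p = 3`): base checks as `rank3PSatCheckC`
with `t = 3^e · m`, `3 ∤ m` in place of `3 ∤ t`; the trivial-`3`-torsion certificate; counts by
`killerLB`; every normalised class served by a lane-0 prime of `Q` (`pWitnessC`) or a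
full-`3`-torsion prime of `QT` (`pWitnessT`). [cite: CremonaAlgorithms1997, §3.5] -/
def rank3PSatCheckT (r : Rank3Row) (ct : Rank3PSatCertT) : Bool :=
  let c := ct.c
  let V := scaleModel r.intModel c.d
  let m := c.t / 3 ^ ct.e
  decide (c.d ≠ 0 ∧ V.Δ ≠ 0 ∧ c.t = 3 ^ ct.e * m ∧ ¬ (3 : ℤ) ∣ (m : ℤ) ∧
      c.X₁ * r.P₁.2.2 = c.d ^ 2 * r.P₁.1 ∧ c.Y₁ * r.P₁.2.2 = c.d ^ 3 * r.P₁.2.1 ∧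
      c.X₂ * r.P₂.2.2 = c.d ^ 2 * r.P₂.1 ∧ c.Y₂ * r.P₂.2.2 = c.d ^ 3 * r.P₂.2.1 ∧
      c.X₃ * r.P₃.2.2 = c.d ^ 2 * r.P₃.1 ∧ c.Y₃ * r.P₃.2.2 = c.d ^ 3 * r.P₃.2.1 ∧
      c.Y₁ ^ 2 + V.a₁ * c.X₁ * c.Y₁ + V.a₃ * c.Y₁ =
        c.X₁ ^ 3 + V.a₂ * c.X₁ ^ 2 + V.a₄ * c.X₁ + V.a₆ ∧
      c.Y₂ ^ 2 + V.a₁ * c.X₂ * c.Y₂ + V.a₃ * c.Y₂ =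
        c.X₂ ^ 3 + V.a₂ * c.X₂ ^ 2 + V.a₄ * c.X₂ + V.a₆ ∧
      c.Y₃ ^ 2 + V.a₁ * c.X₃ * c.Y₃ + V.a₃ * c.Y₃ =
        c.X₃ ^ 3 + V.a₂ * c.X₃ ^ 2 + V.a₄ * c.X₃ + V.a₆) &&
  psi3FactorB V ct.p₀ ct.q₀ ct.c₃ ct.c₂ ct.c₁ ct.c₀ && noRatRootB ct.c₃ ct.c₂ ct.c₁ ct.c₀ ct.m₁ &&
  nonSquareB (threeDiscZ V ct.p₀ ct.q₀) ct.m₂ &&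
  annihilatorCheck c.S c.t && c.S.all (killerLB V) && c.Q.all (killerLB V) &&
  (ct.QT.map fun w => (w.1, w.2.1)).all (killerLB V) &&
  (normTriples 3).all fun abc =>
    c.Q.any (pWitnessC V 3 c.X₁ c.Y₁ c.X₂ c.Y₂ c.X₃ c.Y₃ abc) ||
      ct.QT.any (pWitnessT V c.X₁ c.Y₁ c.X₂ c.Y₂ c.X₃ c.Y₃ abc)

/-- **SOUNDNESS of the lane-T row certificate**: the listed span `ℤP₁ + ℤP₂ + ℤP₃ + E(ℚ)_tors`
is `3`-SATURATED in `E(ℚ) = r.curve⟮ℚ⟯`. [cite: CremonaAlgorithms1997, §3.5]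
[cite: SilvermanAEC2009, III.2.3] -/
theorem Rank3Row.pSaturated_of_pSatCheckT (r : Rank3Row) (h : r.check = true)
    (ct : Rank3PSatCertT) (hc : rank3PSatCheckT r ct = true) :
    ∀ a : r.curve.toAffine.Point,
      3 • a ∈ AddSubgroup.closure {r.gen₁ h, r.gen₂ h, r.gen₃ h} ⊔ AddCommGroup.torsion _ →
        a ∈ AddSubgroup.closure {r.gen₁ h, r.gen₂ h, r.gen₃ h} ⊔ AddCommGroup.torsion _ := by
  simp only [rank3PSatCheckT, Bool.and_eq_true, decide_eq_true_eq] at hc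
  obtain ⟨⟨⟨⟨⟨⟨⟨⟨⟨hd, hΔ, htm, hm, hX₁, hY₁, hX₂, hY₂, hX₃, hY₃, e₁, e₂, e₃⟩, hfac⟩, hcub⟩,
    hD⟩, hann⟩, hS⟩, hQ⟩, hQT⟩, hall⟩ := hc
  exact r.pSaturated_of_scaled h hd hX₁ hY₁ hX₂ hY₂ hX₃ hY₃ hΔ e₁ e₂ e₃ 3
    (pSaturated_of_certPT _ hΔ e₁ e₂ e₃
      (killers_of_all_killerB _ (all_killerB_of_all_killerLB _ hS)) hann htm hm hfac hcub hD
      (all_killerB_of_all_killerLB _ hQ) (all_killerB_of_all_killerLB _ hQT) hall)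

/-- The lane-T Boolean over a list of rows and certificates (same order). [folklore] -/
def rank3PSatCheckTAll : List Rank3Row → List Rank3PSatCertT → Bool
  | [], _ => true
  | _ :: _, [] => false
  | r :: rs, c :: cs => rank3PSatCheckT r c && rank3PSatCheckTAll rs cs

/-- **Soundness of the list form, lane T** — the statement the data files cite.
[cite: CremonaAlgorithms1997, §3.5] -/
theorem Rank3Row.pSaturated_of_pSatCheckTAll :
    ∀ {rows : List Rank3Row} {cs : List Rank3PSatCertT}, rank3PSatCheckTAll rows cs = true →
      ∀ r ∈ rows, ∀ h : r.check = true, ∀ a : r.curve.toAffine.Point,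
        3 • a ∈ AddSubgroup.closure {r.gen₁ h, r.gen₂ h, r.gen₃ h} ⊔ AddCommGroup.torsion _ →
          a ∈ AddSubgroup.closure {r.gen₁ h, r.gen₂ h, r.gen₃ h} ⊔ AddCommGroup.torsion _
  | [], _, _ => by simp
  | _ :: _, [], hc => by simp [rank3PSatCheckTAll] at hc
  | r :: rs, c :: cs, hc => by
    rw [rank3PSatCheckTAll, Bool.and_eq_true] at hc
    intro r' hr'
    rcases List.mem_cons.mp hr' with rfl | hmem
    · exact fun h => r'.pSaturated_of_pSatCheckT h c hc.1
    · exact Rank3Row.pSaturated_of_pSatCheckTAll hc.2 r' hmem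

end Summit.BirchSwinnertonDyer.BirchSwinnertonDyer.Rank2Observatory
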